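import Literature.Analysis.FluidPDE.NSLerayHopfSereginProofs
import Literature.Analysis.FluidPDE.LerayHopfTranslate
import HarnessLib

/-!
# Restarting a Leray–Hopf solution at **every** time (energy inequality from every time of
# strong `L²`-continuity)

Analysis/FluidPDE support file for the continuation / blow-up criteria stated for maximal smooth
solutions (`Literature.Analysis.FluidPDE.leray_blowup_rate_top`, `….seregin_L3_blowup`,
`NSLerayHopf.lean`; decomposition of Leray's rate in `NSLerayBlowupRate.lean`).

The accepted Leray–Hopf predicate `Literature.Analysis.FluidPDE.IsLerayHopfOn` carries the
*strong energy inequality* in the form of Robinson–Rodrigo–Sadowski 2016, Def. 4.9: from `s = 0`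
and from **almost every** `s ∈ (0, T)`. Accordingly the tree's restarting lemmas
(`IsLerayHopfOn.ae_isLerayHopfOn_translate`, `LerayHopfTranslate.lean`;
`IsLerayHopfOn.ae_isLerayHopfOn_restart`, `LerayHopfRestart.lean`) restart the solution from
a.e. time only. For the blow-up criteria one must restart from a *prescribed* time `t₀` (the time
at which `‖u(t₀)‖` is measured), and this file supplies the everywhere versions under strong
`L²`-continuity:

* `IsLerayHopfOn.energy_ineq_every` — if `u` is a Leray–Hopf weak solution of the unforced system
  on `E × [0, T)` which is strongly continuous into `L²` on `(0, T]`, then the energy inequality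
  holds from **every** `s ∈ (0, T)` (for the weak-gradient witness of the structure): it holds
  from a.e. `s' ∈ (s, t)`, and one lets `s' → s⁺` along such times using `E(u(s')) → E(u(s))`
  (`ContinuousInLpOn.tendsto_kineticEnergy`) and `∫_{s'}^t ∫|G|² → ∫_s^t ∫|G|²`
  (`tendsto_setLIntegral_Ioo_left`, absolute continuity of the integral);
* `IsLerayHopfOn.isLerayHopfOn_translate_of_continuousInLpOn` — hence, if `u` is moreover a
  classical solution on `[0, T)`, the translate `u(· + s)` is a Leray–Hopf weak solution on
  `[0, T - s)` from `u(s)` for **every** `s ∈ (0, T)` (the proof of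
  `IsLerayHopfOn.ae_isLerayHopfOn_translate` verbatim, fed with the everywhere energy
  inequality);
* `IsLerayHopfOn.isLerayHopfOn_translate_of_bound` — the case of use: on `ℝ³`, a classical
  Leray–Hopf solution of the unforced Cauchy problem (datum in `L²`) which is bounded on
  `[0, T] × ℝ³` lies in Serrin's class `L^∞(0, T; L^∞)`, so is strongly `L²`-continuous on
  `(0, T]` by the tree's proved Sather–Serrin theorem `continuousInLpOn_two_of_serrin`
  (`NSLerayHopfSereginProofs.lean`; Serrin 1963, §4), and restarts from every time.

This is the classical remark that in a class where the energy *equality* holds "every time is a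
good time" (Robinson–Rodrigo–Sadowski 2016, Cor. 4.8 and the discussion of Def. 4.9; Serrin
1963, §4; Ożański–Pooley 2018, Lemma 6.21 and the semigroup remark following it). All statements
are folklore bookkeeping and fully proved; no named facts are introduced.

## Mathlib / tree search

`lean search 'energy_ineq|isLerayHopfOn_translate|restart'`: only the a.e. versions quoted
above. Used from Mathlib: `MeasureTheory.tendsto_setLIntegral_zero` (absolute continuity of the
lower integral), `le_of_tendsto_of_tendsto`, `mem_closure_iff_nhdsWithin_neBot`,
`ENNReal.Tendsto.sub`; from the tree: `IsLerayHopfOn.tendsto_eLpNorm_sub_nhdsGT`,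
`IsClassicalNSSolutionOn.isWeakNSSolutionOn_translate`, `ae_restrict_Ioo_comp_add_right`,
`setLIntegral_Ioo_comp_add_right` (`LerayHopfTranslate`), `continuousInLpOn_two_of_serrin`,
`memLqLp_top_top_of_bound` (`NSLerayHopfSereginProofs`).

## References

* J. C. Robinson, J. L. Rodrigo, W. Sadowski, *The three-dimensional Navier–Stokes equations.
  Classical theory* (CUP 2016), §4.3: Cor. 4.8, Def. 4.9; Ch. 8 (restarting via the strong
  energy inequality). [RobinsonRodrigoSadowski2016]
* J. Serrin, *The initial value problem for the Navier–Stokes equations*, in: Nonlinear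
  Problems (Madison 1962), Univ. Wisconsin Press 1963, §4 (energy equality in the class
  `L^q L^r`). [Serrin1963]
* W. S. Ożański, B. C. Pooley, *Leray's fundamental work on the Navier–Stokes equations: a
  modern review*, LMS Lecture Notes 452 (CUP 2018), Lemma 6.21 (energy equality from `0` and
  the semigroup property of strong solutions). [OzanskiPooley2018]
* J. Leray, *Sur le mouvement d'un liquide visqueux emplissant l'espace*, Acta Math. 63
  (1934), §17 (3.4), §18. [Leray1934]
-/

noncomputable section

open MeasureTheory TopologicalSpace Set Function Filter Topology
open scoped InnerProductSpace RealInnerProductSpace ENNReal NNReal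

namespace Literature.Analysis.FluidPDE


/-! ### Strong `L²`-continuity gives continuity of the kinetic energy -/

section KineticEnergy

variable {E : Type*} [NormedAddCommGroup E] [InnerProductSpace ℝ E] [FiniteDimensional ℝ E]
  [MeasurableSpace E] [BorelSpace E]

/-- The kinetic energy in terms of the `L²` norm: `E(v) = ½ ‖v‖₂²` for `v ∈ L²`. [folklore] -/
theorem kineticEnergy_eq_half_toReal_eLpNorm_sq {v : E → E} (hv : MemLp v 2 volume) :
    VectorCalculus.kineticEnergy v = 2⁻¹ * (eLpNorm v 2 volume).toReal ^ 2 := by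
  have h1 : eLpNorm v 2 volume ^ 2 = ENNReal.ofReal (2 * VectorCalculus.kineticEnergy v) := by
    rw [← eEnergy_eq_eLpNorm_sq, eEnergy_eq_ofReal _ hv]
  have h2 : (eLpNorm v 2 volume).toReal ^ 2 = 2 * VectorCalculus.kineticEnergy v := by
    rw [← ENNReal.toReal_pow, h1, ENNReal.toReal_ofReal]
    exact mul_nonneg zero_le_two (kineticEnergy_nonneg _)
  rw [h2]
  ring

/-- **Continuity in `L²` gives continuity of the kinetic energy**: if `u ∈ C(S; L²)` then
`t ↦ E(u(t)) = ½‖u(t)‖₂²` is continuous on `S` (within `S`), since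
`|‖u(t)‖₂ - ‖u(t₀)‖₂| ≤ ‖u(t) - u(t₀)‖₂`. [folklore] -/
theorem ContinuousInLpOn.tendsto_kineticEnergy {S : Set ℝ} {u : ℝ → E → E}
    (hc : ContinuousInLpOn S 2 u) {t₀ : ℝ} (ht₀ : t₀ ∈ S) :
    Tendsto (fun t => VectorCalculus.kineticEnergy (u t)) (𝓝[S] t₀)
      (𝓝 (VectorCalculus.kineticEnergy (u t₀))) := by
  set a : ℝ → ℝ := fun t => (eLpNorm (u t) 2 volume).toReal with ha
  have h0 : MemLp (u t₀) 2 volume := hc.1 t₀ ht₀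
  have hd : Tendsto (fun t => (eLpNorm (u t - u t₀) 2 volume).toReal) (𝓝[S] t₀) (𝓝 0) := by
    have := (ENNReal.tendsto_toReal ENNReal.zero_ne_top).comp (hc.2 t₀ ht₀)
    rwa [ENNReal.toReal_zero] at this
  have hat : Tendsto a (𝓝[S] t₀) (𝓝 (a t₀)) := by
    rw [tendsto_iff_norm_sub_tendsto_zero]
    refine squeeze_zero' (Eventually.of_forall fun t => norm_nonneg _) ?_ hd
    filter_upwards [eventually_mem_nhdsWithin] with t ht
    have hi : MemLp (u t) 2 volume := hc.1 t ht
    have hfi : eLpNorm (u t) 2 volume ≠ ⊤ := hi.eLpNorm_ne_top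
    have hf0 : eLpNorm (u t₀) 2 volume ≠ ⊤ := h0.eLpNorm_ne_top
    have hdif : eLpNorm (u t - u t₀) 2 volume ≠ ⊤ := (hi.sub h0).eLpNorm_ne_top
    have h1 : eLpNorm (u t) 2 volume ≤ eLpNorm (u t - u t₀) 2 volume + eLpNorm (u t₀) 2 volume := by
      have := eLpNorm_add_le (hi.sub h0).aestronglyMeasurable h0.aestronglyMeasurable
        (p := 2) (μ := volume) one_le_two
      rwa [sub_add_cancel] at this
    have h2 : eLpNorm (u t₀) 2 volume ≤ eLpNorm (u t - u t₀) 2 volume + eLpNorm (u t) 2 volume := by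
      have := eLpNorm_add_le (h0.sub hi).aestronglyMeasurable hi.aestronglyMeasurable
        (p := 2) (μ := volume) one_le_two
      rwa [sub_add_cancel, eLpNorm_sub_comm] at this
    have h1' := ENNReal.toReal_mono (ENNReal.add_ne_top.2 ⟨hdif, hf0⟩) h1
    have h2' := ENNReal.toReal_mono (ENNReal.add_ne_top.2 ⟨hdif, hfi⟩) h2
    rw [ENNReal.toReal_add hdif hf0] at h1'
    rw [ENNReal.toReal_add hdif hfi] at h2'
    rw [Real.norm_eq_abs, abs_sub_le_iff]
    constructor <;> linarith
  have hsq : Tendsto (fun t => 2⁻¹ * a t ^ 2) (𝓝[S] t₀) (𝓝 (2⁻¹ * a t₀ ^ 2)) :=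
    (hat.pow 2).const_mul 2⁻¹
  rw [kineticEnergy_eq_half_toReal_eLpNorm_sq h0]
  refine hsq.congr' ?_
  filter_upwards [eventually_mem_nhdsWithin] with t ht
  rw [kineticEnergy_eq_half_toReal_eLpNorm_sq (hc.1 t ht)]

end KineticEnergy

/-! ### The energy inequality from every time of strong `L²`-continuity -/

section EveryTime

variable {E : Type*} [NormedAddCommGroup E] [InnerProductSpace ℝ E] [FiniteDimensional ℝ E]
  [MeasurableSpace E] [BorelSpace E]
variable {T ν : ℝ} {u : ℝ → E → E} {u₀ : E → E} {p : ℝ → E → ℝ}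

/-- **Continuity of the dissipation integral in its lower endpoint**: if `∫_{(0,T)} D < ∞` then
`∫_{(s', t)} D → ∫_{(s, t)} D` as `s' → s` from the right, `0 ≤ s` (absolute continuity of the
integral: the piece `∫_{(s, s']} D` has measure `s' - s → 0`). No measurability of `D` is
needed. [folklore] -/
theorem tendsto_setLIntegral_Ioo_left {D : ℝ → ℝ≥0∞} {s t : ℝ} (hs : 0 ≤ s) (htT : t ≤ T)
    (hD : ∫⁻ τ in Ioo 0 T, D τ < ∞) :
    Tendsto (fun s' => ∫⁻ τ in Ioo s' t, D τ) (𝓝[>] s) (𝓝 (∫⁻ τ in Ioo s t, D τ)) := by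
  -- the piece `(s, s']` is small
  set μ : Measure ℝ := volume.restrict (Ioo 0 T) with hμ
  have hfin : ∫⁻ τ, D τ ∂μ ≠ ∞ := hD.ne
  have hmeas : Tendsto (μ ∘ fun s' => Ioc s s') (𝓝[>] s) (𝓝 0) := by
    have h1 : Tendsto (fun s' : ℝ => ENNReal.ofReal (s' - s)) (𝓝[>] s) (𝓝 0) := by
      have h2 : Tendsto (fun s' : ℝ => s' - s) (𝓝 s) (𝓝 (s - s)) :=
        (continuous_id.sub continuous_const).tendsto s
      rw [sub_self] at h2
      have h3 := ENNReal.tendsto_ofReal (h2.mono_left (nhdsWithin_le_nhds (s := Ioi s)))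
      rwa [ENNReal.ofReal_zero] at h3
    refine tendsto_of_tendsto_of_tendsto_of_le_of_le tendsto_const_nhds h1
      (fun _ => bot_le) fun s' => ?_
    simp only [comp_apply, hμ]
    calc volume.restrict (Ioo 0 T) (Ioc s s') ≤ volume (Ioc s s') := Measure.restrict_apply_le _ _
      _ = ENNReal.ofReal (s' - s) := Real.volume_Ioc
  have hsmall : Tendsto (fun s' => ∫⁻ τ in Ioc s s', D τ ∂μ) (𝓝[>] s) (𝓝 0) :=
    tendsto_setLIntegral_zero hfin hmeas
  -- splitting `(s, t) = (s, s'] ∪ (s', t)` for `s < s' < t`, inside `(0, T)`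
  have hsplit : ∀ s' ∈ Ioo s t, ∫⁻ τ in Ioo s t, D τ =
      (∫⁻ τ in Ioc s s', D τ ∂μ) + ∫⁻ τ in Ioo s' t, D τ := by
    intro s' hs'
    have hsub1 : Ioc s s' ⊆ Ioo 0 T := fun τ hτ =>
      ⟨hs.trans_lt hτ.1, (hτ.2.trans_lt hs'.2).trans_le htT⟩
    have hsub2 : Ioo s' t ⊆ Ioo 0 T := fun τ hτ =>
      ⟨(hs.trans_lt hs'.1).trans hτ.1, hτ.2.trans_le htT⟩
    have hsub : Ioo s t ⊆ Ioo 0 T := fun τ hτ => ⟨hs.trans_lt hτ.1, hτ.2.trans_le htT⟩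
    have e1 : ∫⁻ τ in Ioc s s', D τ ∂μ = ∫⁻ τ in Ioc s s', D τ := by
      rw [hμ, Measure.restrict_restrict measurableSet_Ioc, inter_eq_left.2 hsub1]
    rw [e1, ← Ioc_union_Ioo_eq_Ioo hs'.1.le hs'.2,
      lintegral_union measurableSet_Ioo
        (Set.disjoint_left.2 fun τ h1 h2 => lt_irrefl _ (h2.1.trans_le h1.2))]
  -- conclusion
  have hlim : Tendsto (fun s' => (∫⁻ τ in Ioc s s', D τ ∂μ) + ∫⁻ τ in Ioo s' t, D τ) (𝓝[>] s)
      (𝓝 (∫⁻ τ in Ioo s t, D τ)) := by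
    rcases le_or_gt t s with hts | hst
    · -- degenerate: for `s' > s ≥ t` everything vanishes
      have h0 : ∫⁻ τ in Ioo s t, D τ = 0 := by rw [Ioo_eq_empty (not_lt.2 hts)]; simp
      rw [h0]
      have hev : ∀ᶠ s' in 𝓝[>] s, (∫⁻ τ in Ioc s s', D τ ∂μ) + ∫⁻ τ in Ioo s' t, D τ =
          ∫⁻ τ in Ioc s s', D τ ∂μ := by
        filter_upwards [self_mem_nhdsWithin] with s' hs'
        rw [Ioo_eq_empty (not_lt.2 (hts.trans (le_of_lt hs')))]
        simp
      exact hsmall.congr' (hev.mono fun s' hs' => hs'.symm)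
    · refine tendsto_nhds_of_eventually_eq ?_
      filter_upwards [Ioo_mem_nhdsGT hst] with s' hs'
      exact (hsplit s' hs').symm
  have hlim' : Tendsto (fun s' => ((∫⁻ τ in Ioc s s', D τ ∂μ) + ∫⁻ τ in Ioo s' t, D τ) -
      ∫⁻ τ in Ioc s s', D τ ∂μ) (𝓝[>] s) (𝓝 ((∫⁻ τ in Ioo s t, D τ) - 0)) :=
    ENNReal.Tendsto.sub hlim hsmall (Or.inl (lt_of_le_of_lt (lintegral_mono_set
      (show Ioo s t ⊆ Ioo 0 T from fun τ hτ => ⟨hs.trans_lt hτ.1, hτ.2.trans_le htT⟩)) hD).ne)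
  rw [tsub_zero] at hlim'
  refine hlim'.congr' ?_
  filter_upwards [self_mem_nhdsWithin] with s' hs'
  have hfin' : ∫⁻ τ in Ioc s s', D τ ∂μ ≠ ∞ := by
    refine (lt_of_le_of_lt ?_ hD).ne
    rw [hμ, Measure.restrict_restrict measurableSet_Ioc]
    exact lintegral_mono_set inter_subset_right
  rw [ENNReal.add_sub_cancel_left hfin']

/-- **The energy inequality from every time of strong continuity.** Let `u` be a Leray–Hopf
weak solution of the unforced system on `E × [0, T)`, `ν ≥ 0`, which is strongly continuous into
`L²` on `(0, T]` (as is the case in Serrin's class, `continuousInLpOn_two_of_serrin`). Then the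
energy inequality holds from **every** `s ∈ (0, T)`, not only from almost every `s`: for the
weak-gradient witness `G` of the Leray–Hopf structure and all `s < t ≤ T`,
`E(u(t)) + ν ∫ₛᵗ ∫ |G|² ≤ E(u(s))`. Proof: the inequality holds from a.e. `s' ∈ (s, t)`; let
`s' → s⁺` along such times, using `E(u(s')) → E(u(s))` (strong continuity) and
`∫_{s'}^t → ∫_s^t` (`tendsto_setLIntegral_Ioo_left`). This is the remark that in a class where
the energy *equality* holds every time is a "good" restarting time (Robinson–Rodrigo–Sadowski
2016, Def. 4.9 and Cor. 4.8; Serrin 1963, §4). [folklore] -/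
theorem IsLerayHopfOn.energy_ineq_every (h : IsLerayHopfOn T ν 0 u₀ u)
    (hc : ContinuousInLpOn (Ioc 0 T) 2 u) :
    ∃ G : ℝ → E → E →L[ℝ] E,
      (∀ᵐ t ∂(volume.restrict (Ioo 0 T)), HasWeakGradient (u t) (G t)) ∧
      (∫⁻ t in Ioo 0 T, ∫⁻ x, ENNReal.ofReal (frobeniusNormSq (G t x)) < ∞) ∧
      (∀ t ∈ Icc 0 T, VectorCalculus.kineticEnergy (u t) +
        ν * (∫⁻ τ in Ioo 0 t, ∫⁻ x, ENNReal.ofReal (frobeniusNormSq (G τ x))).toReal ≤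
          VectorCalculus.kineticEnergy u₀) ∧
      (∀ᵐ s ∂(volume.restrict (Ioo 0 T)), ∀ t ∈ Icc s T, VectorCalculus.kineticEnergy (u t) +
        ν * (∫⁻ τ in Ioo s t, ∫⁻ x, ENNReal.ofReal (frobeniusNormSq (G τ x))).toReal ≤
          VectorCalculus.kineticEnergy (u s)) ∧
      (∀ s ∈ Ioo 0 T, ∀ t ∈ Icc s T, VectorCalculus.kineticEnergy (u t) +
        ν * (∫⁻ τ in Ioo s t, ∫⁻ x, ENNReal.ofReal (frobeniusNormSq (G τ x))).toReal ≤
          VectorCalculus.kineticEnergy (u s)) := by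
  obtain ⟨G, hG, hGint, h0, hae⟩ := h.weakGrad_energy
  have hforce : ∀ (a b : ℝ) (v : ℝ → E → E),
      ∫ τ in a..b, ∫ x, ⟪(0 : ℝ → E → E) τ x, v τ x⟫ = 0 := by
    intro a b v
    simp
  set D : ℝ → ℝ≥0∞ := fun τ => ∫⁻ x, ENNReal.ofReal (frobeniusNormSq (G τ x)) with hDdef
  have h0' : ∀ t ∈ Icc 0 T, VectorCalculus.kineticEnergy (u t) +
      ν * (∫⁻ τ in Ioo 0 t, D τ).toReal ≤ VectorCalculus.kineticEnergy u₀ := by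
    intro t ht
    have h1 := h0 t ht
    rwa [hforce, add_zero] at h1
  have hae' : ∀ᵐ s ∂(volume.restrict (Ioo 0 T)), ∀ t ∈ Icc s T, VectorCalculus.kineticEnergy (u t) +
      ν * (∫⁻ τ in Ioo s t, D τ).toReal ≤ VectorCalculus.kineticEnergy (u s) := by
    filter_upwards [hae] with s hs t ht
    have h1 := hs t ht
    rwa [hforce, add_zero] at h1
  refine ⟨G, hG, hGint, h0', hae', fun s hs t ht => ?_⟩
  rcases ht.1.eq_or_lt with rfl | hst
  · -- `t = s`
    simp
  -- the set of good times in `(s, t)` accumulates at `s`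
  set A : Set ℝ := {s' ∈ Ioo s t | ∀ t' ∈ Icc s' T, VectorCalculus.kineticEnergy (u t') +
      ν * (∫⁻ τ in Ioo s' t', D τ).toReal ≤ VectorCalculus.kineticEnergy (u s')} with hA
  have hAsub : A ⊆ Ioo s t := fun s' hs' => hs'.1
  have hclos : s ∈ closure A := by
    rw [Metric.mem_closure_iff]
    intro ε hε
    set b : ℝ := min t (s + ε) with hb
    have hsb : s < b := lt_min hst (by linarith)
    have hsub : Ioo s b ⊆ Ioo 0 T := fun τ hτ =>
      ⟨hs.1.trans hτ.1, (hτ.2.trans_le (min_le_left _ _)).trans_le ht.2⟩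
    have hae'' : ∀ᵐ s' ∂(volume.restrict (Ioo s b)), ∀ t' ∈ Icc s' T,
        VectorCalculus.kineticEnergy (u t') + ν * (∫⁻ τ in Ioo s' t', D τ).toReal ≤
          VectorCalculus.kineticEnergy (u s') :=
      ae_mono (Measure.restrict_mono hsub le_rfl) hae'
    -- an a.e. property on an interval of positive length holds somewhere in it
    obtain ⟨s', hs', hgood⟩ : ∃ s' ∈ Ioo s b, ∀ t' ∈ Icc s' T,
        VectorCalculus.kineticEnergy (u t') + ν * (∫⁻ τ in Ioo s' t', D τ).toReal ≤
          VectorCalculus.kineticEnergy (u s') := by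
      by_contra hne
      push Not at hne
      have hfalse : ∀ᵐ s' ∂((volume : Measure ℝ).restrict (Ioo s b)), False := by
        filter_upwards [hae'', ae_restrict_mem measurableSet_Ioo] with s' h1 h2
        obtain ⟨t', ht', hlt⟩ := hne s' h2
        exact absurd (h1 t' ht') (not_le.2 hlt)
      rw [eventually_false_iff_eq_bot, ae_eq_bot, Measure.restrict_eq_zero, Real.volume_Ioo] at hfalse
      exact absurd hfalse (ENNReal.ofReal_pos.2 (by linarith)).ne'
    refine ⟨s', ⟨⟨hs'.1, hs'.2.trans_le (min_le_left _ _)⟩, hgood⟩, ?_⟩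
    rw [Real.dist_eq, abs_sub_comm, abs_of_pos (sub_pos.2 hs'.1)]
    linarith [hs'.2.trans_le (min_le_right t (s + ε))]
  haveI hne : (𝓝[A] s).NeBot := mem_closure_iff_nhdsWithin_neBot.1 hclos
  have hleA : 𝓝[A] s ≤ 𝓝[>] s := nhdsWithin_mono _ fun s' hs' => hs'.1.1
  -- along `A`: the inequality, and the two limits
  have hineq : ∀ᶠ s' in 𝓝[A] s, VectorCalculus.kineticEnergy (u t) +
      ν * (∫⁻ τ in Ioo s' t, D τ).toReal ≤ VectorCalculus.kineticEnergy (u s') :=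
    eventually_mem_nhdsWithin.mono fun s' hs' => hs'.2 t ⟨hs'.1.2.le, ht.2⟩
  have hlimL : Tendsto (fun s' => VectorCalculus.kineticEnergy (u t) + ν * (∫⁻ τ in Ioo s' t, D τ).toReal)
      (𝓝[A] s) (𝓝 (VectorCalculus.kineticEnergy (u t) + ν * (∫⁻ τ in Ioo s t, D τ).toReal)) := by
    have h1 := (tendsto_setLIntegral_Ioo_left (D := D) hs.1.le ht.2 hGint).mono_left hleA
    have hfin : ∫⁻ τ in Ioo s t, D τ ≠ ∞ :=
      (lt_of_le_of_lt (lintegral_mono_set (show Ioo s t ⊆ Ioo 0 T from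
        fun τ hτ => ⟨hs.1.trans hτ.1, hτ.2.trans_le ht.2⟩)) hGint).ne
    exact (((ENNReal.tendsto_toReal hfin).comp h1).const_mul ν).const_add _
  have hlimR : Tendsto (fun s' => VectorCalculus.kineticEnergy (u s')) (𝓝[A] s)
      (𝓝 (VectorCalculus.kineticEnergy (u s))) :=
    (hc.tendsto_kineticEnergy ⟨hs.1, hs.2.le⟩).mono_left
      (nhdsWithin_mono _ (show A ⊆ Ioc 0 T from
        fun s' hs' => ⟨hs.1.trans hs'.1.1, (hs'.1.2.trans_le ht.2).le⟩))
  exact le_of_tendsto_of_tendsto hlimL hlimR hineq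

/-- **Restarting at every time.** Let `ν ≥ 0` and let `u` be a Leray–Hopf weak solution of the
unforced system on `E × [0, T)` which is a classical solution on `[0, T)` and strongly
continuous into `L²` on `(0, T]`. Then for **every** `s ∈ (0, T)` the translate `u(· + s)` is a
Leray–Hopf weak solution on `E × [0, T - s)` from the datum `u(s)` — the everywhere version of
the a.e. restarting lemma `IsLerayHopfOn.ae_isLerayHopfOn_translate` (`LerayHopfTranslate`):
the energy inequality from `s` is `IsLerayHopfOn.energy_ineq_every`, everything else is as
there (weak formulation of the translate of a classical solution, translated bounds and weak
gradient, weak continuity on `(0, T] ∋ s`, strong right-continuity at `s` from the energy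
inequality, `IsLerayHopfOn.tendsto_eLpNorm_sub_nhdsGT`). (Robinson–Rodrigo–Sadowski 2016, Def. 4.9
with Cor. 4.8; in Serrin's class every time is good: Serrin 1963, §4.) [folklore] -/
theorem IsLerayHopfOn.isLerayHopfOn_translate_of_continuousInLpOn (hLH : IsLerayHopfOn T ν 0 u₀ u)
    (hcl : IsClassicalNSSolutionOn (Ico 0 T) ν 0 u p) (hν : 0 ≤ ν)
    (hc : ContinuousInLpOn (Ioc 0 T) 2 u) {s : ℝ} (hsI : s ∈ Ioo 0 T) :
    IsLerayHopfOn (T - s) ν 0 (u s) (fun t => u (t + s)) := by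
  obtain ⟨C, hC⟩ := hLH.energy_bound
  obtain ⟨G, hG, hGint, -, hae, hall⟩ := hLH.energy_ineq_every hc
  have hs := hall s hsI
  -- notation and elementary facts
  set g : ℝ → ℝ≥0∞ := fun τ => ∫⁻ x, ENNReal.ofReal (frobeniusNormSq (G τ x)) with hg
  have hforce : ∀ (a b : ℝ) (v : ℝ → E → E),
      ∫ τ in a..b, ∫ x, ⟪(0 : ℝ → E → E) τ x, v τ x⟫ = 0 := by
    intro a b v
    simp
  have hEs : ∀ t ∈ Icc s T, VectorCalculus.kineticEnergy (u t) ≤ VectorCalculus.kineticEnergy (u s) := by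
    intro t ht
    have h1 := hs t ht
    have h2 : 0 ≤ ν * (∫⁻ τ in Ioo s t, ∫⁻ x, ENNReal.ofReal (frobeniusNormSq (G τ x))).toReal :=
      mul_nonneg hν ENNReal.toReal_nonneg
    linarith
  have hsub : Ioo (0 + s) (T - s + s) ⊆ Ioo 0 T := fun t ht =>
    ⟨by linarith [ht.1, hsI.1], by linarith [ht.2]⟩
  have hμ : volume.restrict (Ioo (0 + s) (T - s + s)) ≤ volume.restrict (Ioo 0 T) :=
    Measure.restrict_mono hsub le_rfl
  -- the shift `t ↦ t + s` at the filters `𝓝[>] 0 → 𝓝 s`, `𝓝[>] 0 → 𝓝[>] s`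
  have hsh : Tendsto (fun t : ℝ => t + s) (𝓝[>] (0 : ℝ)) (𝓝 s) := by
    have h1 : Tendsto (fun t : ℝ => t + s) (𝓝 0) (𝓝 (0 + s)) :=
      (continuous_id.add continuous_const).tendsto 0
    rw [zero_add] at h1
    exact h1.mono_left nhdsWithin_le_nhds
  have hsh' : Tendsto (fun t : ℝ => t + s) (𝓝[>] (0 : ℝ)) (𝓝[>] s) := by
    refine tendsto_nhdsWithin_iff.2 ⟨hsh, ?_⟩
    filter_upwards [self_mem_nhdsWithin] with t ht
    exact show s < t + s by linarith [mem_Ioi.1 ht]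
  refine
    { weak := ?_
      energy_bound := ⟨C, ae_restrict_Ioo_comp_add_right s (ae_mono hμ hC)⟩
      memLp := fun t ht => hLH.memLp (t + s) ⟨by linarith [ht.1, hsI.1], by linarith [ht.2]⟩
      weakGrad_energy := ⟨fun t => G (t + s), ae_restrict_Ioo_comp_add_right s (ae_mono hμ hG),
        ?_, ?_, ?_⟩
      weak_continuous := fun w hw => ?_
      strong_initial := (hLH.tendsto_eLpNorm_sub_nhdsGT hsI hEs).comp hsh' }
  · -- weak formulation
    have hw := hcl.isWeakNSSolutionOn_translate ⟨C, hC⟩ ⟨hsI.1.le, hsI.2⟩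
    simpa only [Pi.zero_def] using hw
  · -- `∇u(· + s) ∈ L²_{t,x}`
    have h1 := setLIntegral_Ioo_comp_add_right g 0 (T - s) s
    calc ∫⁻ t in Ioo 0 (T - s), ∫⁻ x, ENNReal.ofReal (frobeniusNormSq (G (t + s) x))
        = ∫⁻ t in Ioo (0 + s) (T - s + s), g t := h1
      _ ≤ ∫⁻ t in Ioo 0 T, g t := lintegral_mono_set hsub
      _ < ∞ := hGint
  · -- energy inequality from `0` (= from `s` for `u`)
    intro t ht
    rw [hforce, add_zero, setLIntegral_Ioo_comp_add_right g 0 t s, zero_add]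
    exact hs (t + s) ⟨by linarith [ht.1], by linarith [ht.2]⟩
  · -- energy inequality from a.e. `s'`
    have h1 := ae_restrict_Ioo_comp_add_right s (ae_mono hμ hae)
    filter_upwards [h1] with s' hs' t ht
    rw [hforce, add_zero, setLIntegral_Ioo_comp_add_right g s' t s]
    exact hs' (t + s) ⟨by linarith [ht.1], by linarith [ht.2]⟩
  · -- weak `L²` continuity on `(0, T - s]` and the weak limit at `0⁺`
    obtain ⟨hco, -⟩ := hLH.weak_continuous w hw
    refine ⟨hco.comp (continuousOn_id.add continuousOn_const) fun t ht =>
      ⟨by linarith [ht.1, hsI.1], by linarith [ht.2]⟩, ?_⟩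
    exact (hco.continuousAt (Ioc_mem_nhds hsI.1 hsI.2)).tendsto.comp hsh

end EveryTime


/-! ### The case of use: bounded classical Leray–Hopf solutions on `ℝ³` -/

section R3

/-- **Restarting at every time, for bounded classical Leray–Hopf solutions on `ℝ³`.** Let
`ν > 0`, `T > 0`, and let `u` be a Leray–Hopf weak solution of the unforced Cauchy problem on
`ℝ³ × [0, T)` with datum `u₀ ∈ L²`, which is a classical solution on `[0, T)` and is bounded
(pointwise) on `[0, T] × ℝ³`. Then for **every** `s ∈ (0, T)` the translate `u(· + s)` is a
Leray–Hopf weak solution on `[0, T - s)` from `u(s)`. Indeed `u` lies in Serrin's class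
`L^∞(0, T; L^∞)` (`memLqLp_top_top_of_bound`), hence is strongly `L²`-continuous on `(0, T]`
(Sather–Serrin: the proved `continuousInLpOn_two_of_serrin`; Serrin 1963, §4), and
`IsLerayHopfOn.isLerayHopfOn_translate_of_continuousInLpOn` applies. This is the "semigroup
property" of strong solutions (Ożański–Pooley 2018, remark after Lemma 6.21) in the Leray–Hopf
vocabulary of the tree. [folklore] -/
theorem IsLerayHopfOn.isLerayHopfOn_translate_of_bound {ν T : ℝ} (hν : 0 < ν) (hT : 0 < T)
    {u : ℝ → EuclideanSpace ℝ (Fin 3) → EuclideanSpace ℝ (Fin 3)}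
    {p : ℝ → EuclideanSpace ℝ (Fin 3) → ℝ} {u₀ : EuclideanSpace ℝ (Fin 3) → EuclideanSpace ℝ (Fin 3)}
    (hLH : IsLerayHopfOn T ν 0 u₀ u) (hu₀ : MemLp u₀ 2 volume)
    (hcl : IsClassicalNSSolutionOn (Ico 0 T) ν 0 u p)
    {M : ℝ} (hM : ∀ t ∈ Icc 0 T, ∀ x, ‖u t x‖ ≤ M) {s : ℝ} (hs : s ∈ Ioo 0 T) :
    IsLerayHopfOn (T - s) ν 0 (u s) (fun t => u (t + s)) := by
  have hmeas : ∀ t ∈ Icc 0 T, AEStronglyMeasurable (u t) volume := fun t ht => (hLH.memLp t ht).1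
  have hS : MemLqLp ∞ ∞ u (Ioo 0 T) := memLqLp_top_top_of_bound hmeas hM
  have hc : ContinuousInLpOn (Ioc 0 T) 2 u :=
    continuousInLpOn_two_of_serrin hν hT hLH hu₀ (q := ∞) (r := ∞) (by simp) (by simp) hS
  exact hLH.isLerayHopfOn_translate_of_continuousInLpOn hcl hν.le hc hs

end R3

end Literature.Analysis.FluidPDE

end
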